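import Literature.Probability.RandomPlanarGeometry.ChordalCapacityDivergence
import Literature.Probability.RandomPlanarGeometry.HullApproximation
import Literature.Probability.RandomPlanarGeometry.ConformalRestrictionProofs
import Summits.CriticalPhenomena.SAWScalingLimit.Theorems.SAWLoopFugacityFlowSimpleSubseqLimitsLineGlue
import HarnessLib

/-!
# The sandwich — helper stub `stub_rangeIsArc_sandwich` of the line `marked-point-revisit`
(crux `SAWLoopFugacityFlow.SimpleSubseqLimits`, stmt-CriticalPhenomena-4982; plan `RangeIsArc-PLAN.md`, H7)

Measure-theoretic core of the agreement step of `stub_rangeIsArc_tests`. Let `φ : ℍ → D` be a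
conformal chart of the Dobrushin domain `(D; a, b)`, `T ⊆ ℂ` a test set, and `D'_n` hull
subdomains of `D` with carriers `φ(ℍ ∖ J n)` for a DECREASING sequence of sets `J n`, so that the
admissible events `E_n = {range ⊆ closure D'_n}` increase. If two finite measures `ν`, `μ`
carried by classes from `a` to `b` with trace in `D ∪ {a, b}` satisfy `AvoidanceAgree D ν μ`
(the vocabulary of the line, `Glue.AvoidanceAgree`: they agree on the events `E(D')` of all
admissible `D'`), and on the carrier (i) each `E_n` implies avoidance of `φ̄(T)` and
(ii) avoidance implies some `E_n`, then `ν {range ∩ φ̄(T) = ∅} = μ {range ∩ φ̄(T) = ∅}`: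
the avoidance event is a.e. the increasing union `⋃ E_n`, whose mass is `sup ν(E_n) = sup μ(E_n)`
(hull subdomains are admissible: `exists_ball_agree`).

Also PROVED here, for the users of the sandwich: the dictionary between `range ⊆ closure D'`
and the pulled-back trace (`symm_notMem_interior`, `range_subset_closure_of_forall_notMem`), the
closedness of the pulled-back trace `{0} ∪ φ⁻¹(range ∩ D)` of a class from `a` to `b` in
`D ∪ {a, b}` (`isClosed_pullback`, Carathéodory boundary behaviour of `φ⁻¹` at `a` and `b`:
`IsChordalUniformizing.tendsto_symm_nhds_zero/cocompact`), and eventual avoidance of a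
decreasing sequence of closed hulls whose intersection is avoided (`exists_forall_notMem`).
-/

noncomputable section

open MeasureTheory Filter Topology Set Metric Bornology
open Literature.Probability.RandomPlanarGeometry
open UpperHalfPlane (upperHalfPlaneSet isOpen_upperHalfPlaneSet)
open Summit.CriticalPhenomena.SAWScalingLimit.Theorems.SimpleSubseqLimits.MarkedPointRevisit.Glue
open scoped ENNReal NNReal unitInterval

namespace Summit.CriticalPhenomena.SAWScalingLimit.Theorems.SimpleSubseqLimits.MarkedPointRevisit.ArcRangeSandwich

variable {D : DobrushinDomain} {φ : ConformalEquiv upperHalfPlaneSet D.carrier}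

/-! ### Hull subdomains are admissible for `AvoidanceAgree` -/

/-- A hull subdomain agrees with the domain in small balls about the marked points. [folklore] -/
theorem exists_ball_agree {D' : DobrushinDomain} (h : D.IsHullSubdomain D') :
    ∃ ε : ℝ, 0 < ε ∧ D'.carrier ∩ ball (D.pt 0) ε = D.carrier ∩ ball (D.pt 0) ε ∧
      D'.carrier ∩ ball (D.pt 1) ε = D.carrier ∩ ball (D.pt 1) ε := by
  have key : ∀ {p : ℂ}, p ∉ closure (D.carrier \ D'.carrier) →
      ∃ ε > 0, ∀ ε' ≤ ε, D'.carrier ∩ ball p ε' = D.carrier ∩ ball p ε' := by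
    intro p hp
    rw [Metric.mem_closure_iff] at hp
    push Not at hp
    obtain ⟨ε, hε, hfar⟩ := hp
    refine ⟨ε, hε, fun ε' hε' ↦ Subset.antisymm (fun z hz ↦ ⟨h.carrier_subset hz.1, hz.2⟩)
      fun z hz ↦ ⟨?_, hz.2⟩⟩
    by_contra hzD'
    have := hfar z ⟨hz.1, hzD'⟩
    have hz2 : dist p z < ε := by rw [dist_comm]; exact lt_of_lt_of_le hz.2 hε'
    exact absurd hz2 (not_lt.2 this)
  obtain ⟨ε₀, hε₀, h₀⟩ := key h.pt_zero_notMem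
  obtain ⟨ε₁, hε₁, h₁⟩ := key h.pt_one_notMem
  exact ⟨min ε₀ ε₁, lt_min hε₀ hε₁, h₀ _ (min_le_left _ _), h₁ _ (min_le_right _ _)⟩

/-! ### Dictionary between `range ⊆ closure D'` and the pulled-back trace -/

/-- If `w ∈ D` is in the closure of `φ(ℍ ∖ J)` then `φ⁻¹ w ∈ closure (ℍ ∖ J)`. [folklore] -/
theorem symm_mem_closure_of_mem_closure_image {J : Set ℂ} {w : ℂ} (hw : w ∈ D.carrier)
    (hcl : w ∈ closure (φ '' (upperHalfPlaneSet \ J))) :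
    φ.symm w ∈ closure (upperHalfPlaneSet \ J) := by
  have h1 : ContinuousWithinAt φ.symm (φ '' (upperHalfPlaneSet \ J)) w :=
    (φ.symm.continuousOn.continuousAt (D.isOpen.mem_nhds hw)).continuousWithinAt
  have h2 := h1.mem_closure_image hcl
  refine closure_mono ?_ h2
  rintro _ ⟨_, ⟨z, hz, rfl⟩, rfl⟩
  rw [φ.symm_apply_apply hz.1]
  exact hz

/-- A point of `interior J` is not in `closure (ℍ ∖ J)`. [folklore] -/
theorem notMem_interior_of_mem_closure_diff {J : Set ℂ} {z : ℂ}
    (hz : z ∈ closure (upperHalfPlaneSet \ J)) : z ∉ interior J := by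
  intro hzi
  rw [mem_closure_iff_nhds] at hz
  obtain ⟨u, hu, hu'⟩ := hz (interior J) (isOpen_interior.mem_nhds hzi)
  exact hu'.2 (interior_subset hu)

/-- **(i) of the sandwich**: if the trace lies in `closure (φ(ℍ ∖ J))` then the pulled-back trace
misses `interior J`. [folklore] -/
theorem symm_notMem_interior {J : Set ℂ} {c : CurveClass ℂ}
    (h : c.range ⊆ closure (φ '' (upperHalfPlaneSet \ J))) {w : ℂ} (hw : w ∈ c.range ∩ D.carrier) :
    φ.symm w ∉ interior J :=
  notMem_interior_of_mem_closure_diff (symm_mem_closure_of_mem_closure_image hw.2 (h hw.1))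

/-- **(ii) of the sandwich**: if the pulled-back trace misses `J` then the trace lies in the
closure of the hull subdomain `D'` with carrier `φ(ℍ ∖ J)`. [folklore] -/
theorem range_subset_closure_of_forall_notMem {J : Set ℂ} {D' : DobrushinDomain}
    (hD' : D.IsHullSubdomain D') (hcar : D'.carrier = φ '' (upperHalfPlaneSet \ J))
    {c : CurveClass ℂ} (hr : c.range ⊆ D.carrier ∪ {D.pt 0, D.pt 1})
    (h : ∀ w ∈ c.range ∩ D.carrier, φ.symm w ∉ J) : c.range ⊆ closure D'.carrier := by
  intro w hw
  rcases hr hw with hwD | hab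
  · refine subset_closure ?_
    rw [hcar]
    exact ⟨φ.symm w, ⟨φ.symm_mapsTo hwD, h w ⟨hw, hwD⟩⟩, φ.apply_symm_apply hwD⟩
  · rcases hab with rfl | rfl
    · rw [← hD'.pt_zero_eq]; exact frontier_subset_closure (D'.pt_mem_frontier 0)
    · rw [← hD'.pt_one_eq]; exact frontier_subset_closure (D'.pt_mem_frontier 1)

/-- A subset of `D ∪ {a, b}` lies in `closure D`. [folklore] -/
theorem range_subset_closure_self {R : Set ℂ} (hr : R ⊆ D.carrier ∪ {D.pt 0, D.pt 1}) :
    R ⊆ closure D.carrier := by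
  intro w hw
  rcases hr hw with h | h
  · exact subset_closure h
  · rcases h with rfl | rfl <;> exact frontier_subset_closure (D.pt_mem_frontier _)

/-! ### The pulled-back trace of a class from `a` to `b` in `D ∪ {a, b}` is closed -/

/-- The set `{0} ∪ φ⁻¹(trace ∩ D)` is closed (Carathéodory: `φ⁻¹ → 0` at `a`, `→ ∞` at `b`).
[folklore] -/
theorem isClosed_pullback (hφ : D.IsChordalUniformizing φ) {c : CurveClass ℂ}
    (hr : c.range ⊆ D.carrier ∪ {D.pt 0, D.pt 1}) :
    IsClosed (insert (0 : ℂ) (φ.symm '' (c.range ∩ D.carrier))) := by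
  refine isClosed_of_closure_subset fun z hz ↦ ?_
  rw [insert_eq, closure_union, closure_singleton] at hz
  rcases hz with hz0 | hz
  · rw [mem_singleton_iff.1 hz0]; exact mem_insert _ _
  obtain ⟨u, hu, hlim⟩ := mem_closure_iff_seq_limit.1 hz
  choose w hw hwu using hu
  -- a convergent subsequence of `w` in the compact trace
  obtain ⟨p, hp, ψ, hψ, hwlim⟩ := c.isCompact_range.tendsto_subseq fun n ↦ (hw n).1
  have hlim' : Tendsto (fun n ↦ φ.symm (w (ψ n))) atTop (𝓝 z) := by
    have := hlim.comp hψ.tendsto_atTop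
    refine this.congr fun n ↦ ?_
    simp only [Function.comp_apply, hwu]
  have hwD : Tendsto (fun n ↦ w (ψ n)) atTop (𝓝[D.carrier] p) :=
    tendsto_nhdsWithin_iff.2 ⟨hwlim, Eventually.of_forall fun n ↦ (hw (ψ n)).2⟩
  rcases hr hp with hpD | hab
  · -- `p ∈ D`: continuity of `φ⁻¹`
    have h1 : Tendsto (fun n ↦ φ.symm (w (ψ n))) atTop (𝓝 (φ.symm p)) :=
      ((φ.symm.continuousOn.continuousAt (D.isOpen.mem_nhds hpD)).tendsto).comp hwlim
    have : z = φ.symm p := tendsto_nhds_unique hlim' h1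
    exact mem_insert_of_mem _ ⟨p, ⟨hp, hpD⟩, this.symm⟩
  · rcases hab with rfl | rfl
    · -- `p = a`: `φ⁻¹ → 0`
      have h1 := hφ.tendsto_symm_nhds_zero.comp hwD
      have : z = 0 := tendsto_nhds_unique hlim' h1
      rw [this]; exact mem_insert _ _
    · -- `p = b`: `φ⁻¹ → ∞`, impossible for a convergent sequence
      exfalso
      have h1 := hφ.tendsto_symm_cocompact.comp hwD
      have h2 : ∀ᶠ n in atTop, φ.symm (w (ψ n)) ∈ (closedBall z 1)ᶜ :=
        h1 ((isCompact_closedBall z 1).compl_mem_cocompact)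
      have h3 : ∀ᶠ n in atTop, φ.symm (w (ψ n)) ∈ closedBall z 1 :=
        hlim' (closedBall_mem_nhds z one_pos)
      obtain ⟨n, hn, hn'⟩ := (h2.and h3).exists
      exact hn hn'

/-- **Eventual avoidance of decreasing hulls.** If the pulled-back trace misses the intersection
`F` of a decreasing sequence of closed sets `J n` with `J 0` bounded (and `0 ∉ F`), it misses
some `J n`. [folklore] -/
theorem exists_forall_notMem (hφ : D.IsChordalUniformizing φ) {c : CurveClass ℂ}
    (hr : c.range ⊆ D.carrier ∪ {D.pt 0, D.pt 1}) {J : ℕ → Set ℂ} (hJc : ∀ n, IsClosed (J n))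
    (hJa : Antitone J) (hJb : IsBounded (J 0)) (h0 : (0 : ℂ) ∉ ⋂ n, J n)
    (h : ∀ w ∈ c.range ∩ D.carrier, φ.symm w ∉ ⋂ n, J n) :
    ∃ n, ∀ w ∈ c.range ∩ D.carrier, φ.symm w ∉ J n := by
  obtain ⟨R, hR⟩ := hJb.subset_closedBall 0
  set K := insert (0 : ℂ) (φ.symm '' (c.range ∩ D.carrier)) ∩ closedBall 0 R with hK
  have hKc : IsCompact K := (isCompact_closedBall 0 R).inter_left (isClosed_pullback hφ hr)
  have hKF : Disjoint K (⋂ n, J n) := by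
    rw [Set.disjoint_left]
    rintro z ⟨hz, -⟩ hzF
    rcases hz with rfl | ⟨w, hw, rfl⟩
    · exact h0 hzF
    · exact h w hw hzF
  obtain ⟨n, hn⟩ := (eventually_disjoint_of_iInter_eq hJc hJa rfl hKc hKF).exists
  refine ⟨n, fun w hw hwJ ↦ ?_⟩
  have hwK : φ.symm w ∈ K := ⟨mem_insert_of_mem _ ⟨w, hw, rfl⟩, hR (hJa (Nat.zero_le n) hwJ)⟩
  exact Set.disjoint_left.1 hn hwK hwJ

/-! ### The sandwich -/

/-- **Sandwich.** Avoidance of the image test set `φ̄(T)` is squeezed between the increasing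
admissible events `{range ⊆ closure D'_n}` of hull subdomains with carriers `φ(ℍ ∖ J n)`:
if on the carriers (i) each such event implies avoidance and (ii) avoidance implies some such
event, the two measures give avoidance the same mass. [folklore] -/
theorem measure_eq_of_sandwich {T : Set ℂ} {ν μ : Measure (CurveClass ℂ)} [IsFiniteMeasure ν]
    [IsFiniteMeasure μ]
    (hν : ∀ᵐ c ∂ν, c.source = D.pt 0 ∧ c.target = D.pt 1 ∧ c.range ⊆ D.carrier ∪ {D.pt 0, D.pt 1})
    (hμ : ∀ᵐ c ∂μ, c.source = D.pt 0 ∧ c.target = D.pt 1 ∧ c.range ⊆ D.carrier ∪ {D.pt 0, D.pt 1})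
    (hA : AvoidanceAgree D ν μ) (J : ℕ → Set ℂ) (D' : ℕ → DobrushinDomain)
    (hD' : ∀ n, D.IsHullSubdomain (D' n))
    (hcar : ∀ n, (D' n).carrier = φ '' (upperHalfPlaneSet \ J n)) (hJ : Antitone J)
    (hi : ∀ c : CurveClass ℂ, c.source = D.pt 0 → c.target = D.pt 1 →
      c.range ⊆ D.carrier ∪ {D.pt 0, D.pt 1} → ∀ n, c.range ⊆ closure (D' n).carrier →
      Disjoint c.range (φ.boundaryExtension '' T))
    (hii : ∀ c : CurveClass ℂ, c.source = D.pt 0 → c.target = D.pt 1 →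
      c.range ⊆ D.carrier ∪ {D.pt 0, D.pt 1} → Disjoint c.range (φ.boundaryExtension '' T) →
      ∃ n, c.range ⊆ closure (D' n).carrier) :
    ν (CurveClass.rangeSubset (φ.boundaryExtension '' T)ᶜ) =
      μ (CurveClass.rangeSubset (φ.boundaryExtension '' T)ᶜ) := by
  set E : ℕ → Set (CurveClass ℂ) := fun n ↦ CurveClass.rangeSubset (closure (D' n).carrier) with hE
  have hEmono : Monotone E := by
    intro n m hnm c hc
    refine hc.trans (closure_mono ?_)
    rw [hcar n, hcar m]
    exact image_mono (sdiff_subset_sdiff_right (hJ hnm))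
  have hEeq : ∀ n, ν (E n) = μ (E n) := fun n ↦
    hA (D' n) (hD' n).carrier_subset (hD' n).pt_zero_eq (hD' n).pt_one_eq (exists_ball_agree (hD' n))
  -- on the carriers, avoidance is `⋃ E n`
  have hae : ∀ {ρ : Measure (CurveClass ℂ)},
      (∀ᵐ c ∂ρ, c.source = D.pt 0 ∧ c.target = D.pt 1 ∧ c.range ⊆ D.carrier ∪ {D.pt 0, D.pt 1}) →
      ρ (CurveClass.rangeSubset (φ.boundaryExtension '' T)ᶜ) = ρ (⋃ n, E n) := by
    intro ρ hρ
    refine measure_congr ?_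
    filter_upwards [hρ] with c hc
    refine propext ⟨fun h ↦ ?_, fun h ↦ ?_⟩
    · have h' : Disjoint c.range (φ.boundaryExtension '' T) := CurveClass.disjoint_range_iff.2 h
      obtain ⟨n, hn⟩ := hii c hc.1 hc.2.1 hc.2.2 h'
      exact mem_iUnion.2 ⟨n, hn⟩
    · obtain ⟨n, hn⟩ := mem_iUnion.1 h
      exact CurveClass.disjoint_range_iff.1 (hi c hc.1 hc.2.1 hc.2.2 n hn)
  rw [hae hν, hae hμ, hEmono.measure_iUnion, hEmono.measure_iUnion]
  exact iSup_congr hEeq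


/-- **Registered form of the sandwich** (`measure_eq_of_sandwich` with all binders explicit).
[folklore] -/
theorem stub_rangeIsArc_sandwich :
    ∀ (D : DobrushinDomain) (φ : ConformalEquiv upperHalfPlaneSet D.carrier) (T : Set ℂ)
      (ν μ : Measure (CurveClass ℂ)) (J : ℕ → Set ℂ) (D' : ℕ → DobrushinDomain),
      IsFiniteMeasure ν → IsFiniteMeasure μ →
      (∀ᵐ c ∂ν, c.source = D.pt 0 ∧ c.target = D.pt 1 ∧ c.range ⊆ D.carrier ∪ {D.pt 0, D.pt 1}) →
      (∀ᵐ c ∂μ, c.source = D.pt 0 ∧ c.target = D.pt 1 ∧ c.range ⊆ D.carrier ∪ {D.pt 0, D.pt 1}) →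
      AvoidanceAgree D ν μ → (∀ n, D.IsHullSubdomain (D' n)) →
      (∀ n, (D' n).carrier = φ '' (upperHalfPlaneSet \ J n)) → Antitone J →
      (∀ c : CurveClass ℂ, c.source = D.pt 0 → c.target = D.pt 1 →
        c.range ⊆ D.carrier ∪ {D.pt 0, D.pt 1} → ∀ n, c.range ⊆ closure (D' n).carrier →
        Disjoint c.range (φ.boundaryExtension '' T)) →
      (∀ c : CurveClass ℂ, c.source = D.pt 0 → c.target = D.pt 1 →
        c.range ⊆ D.carrier ∪ {D.pt 0, D.pt 1} → Disjoint c.range (φ.boundaryExtension '' T) →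
        ∃ n, c.range ⊆ closure (D' n).carrier) →
      ν (CurveClass.rangeSubset (φ.boundaryExtension '' T)ᶜ) =
        μ (CurveClass.rangeSubset (φ.boundaryExtension '' T)ᶜ) := by
  intro D φ T ν μ J D' _ _ hν hμ hA hD' hcar hJ hi hii
  exact measure_eq_of_sandwich hν hμ hA J D' hD' hcar hJ hi hii

end Summit.CriticalPhenomena.SAWScalingLimit.Theorems.SimpleSubseqLimits.MarkedPointRevisit.ArcRangeSandwich

end
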